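/-
Copyright: H21 programme, solo seat `solo-RiemannHypothesis-informed` (session 5).
-/
import Summits.RiemannHypothesis.RiemannHypothesis.Theorems.SoloInformedMultiPair
import Summits.RiemannHypothesis.RiemannHypothesis.Theorems.SoloInformedUndodgedNear
import Summits.RiemannHypothesis.RiemannHypothesis.Theorems.SoloInformedClusterTestEq

/-!
# The cluster wall with un-dodged members (solo-informed, T33‴/T34‴)

T33/T34 of `SoloInformedClusterFarDecay` with a further finite set `P` of off-line zeros lying
within `δ₁` of the pair `½ ± η + iγ₀` (`256(c+1)δ₁ ≤ η`, `64(N+1)δ₁ ≤ δ`), which are NOT dodged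
and are exempted from the local hypothesis: by T37b (`undodged_condition_near_pair`) the twisted
transform of the cluster test is gain-signed there, `|ĝ(ρ)|² ≤ ½|ĝ(ρ) − ĝ(1 − ρ̄)|²`, so by T37a
(`weilGroundEnergy_neg_of_local_oddTest_cluster_far_undodged`) they only help; the window
inequality and every constant are those of T33/T34.  This is the input of the δ-free wall T38
(`SoloInformedDeltaFree`), where `δ` and `δ₁` are produced by pigeonhole.
-/

open MeasureTheory Complex Set Filter Topology Literature.NumberTheory.LFunctions
open scoped ContDiff ComplexConjugate

namespace Summit.RiemannHypothesis.RiemannHypothesis.Theorems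

variable {ψ : ℝ → ℝ}

/-- **T33‴ (T33 with un-dodged members).**  As T33 (`SoloInformedClusterFarDecay`), with a
further finite set `P` of off-line zeros within `δ₁` of the pair, `256(c+1)δ₁ ≤ η`,
`64(N+1)δ₁ ≤ δ`, exempted from the local hypothesis, and the gain regime
`2Φ(−η) ≤ e^{ηc}Φ(η)`; the window inequality is unchanged (the members of `P` contribute with
the sign of the gain, T37a/b). -/
theorem weilGroundEnergy_neg_of_farOffset_cluster_undodged_eff (hψ : ContDiff ℝ ∞ ψ)
    (hsupp : tsupport ψ ⊆ Icc (-1) 1) (hψ0 : ∀ s, 0 ≤ ψ s) (N : ℕ) (R₀ : ℝ) (p : ℕ) :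
    ∀ (η θ γ₀ c R δ Δ₀ δ₁ : ℝ) (S' P : Finset ℂ), 0 < η → η < 1 / 2 → θ < 1 / 2 → γ₀ ≠ 0 →
      0 ≤ c → 1 ≤ R → Real.exp (c + 1) ≤ R ^ 2 → 0 < δ → δ ≤ 1 → 1 ≤ Δ₀ →
      riemannZeta (1 / 2 + η + γ₀ * I) = 0 → S'.card ≤ N →
      (∀ ρ ∈ S', ‖ρ - (1 / 2 + γ₀ * I)‖ ≤ R₀ ∧ δ ≤ ‖ρ - (1 / 2 + η + γ₀ * I)‖ ∧
          δ ≤ ‖ρ - (1 / 2 - η + γ₀ * I)‖) →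
      0 ≤ δ₁ → 256 * (c + 1) * δ₁ ≤ η → 64 * (N + 1) * δ₁ ≤ δ →
      (∀ ρ ∈ P, riemannZeta ρ = 0 ∧ 0 ≤ ρ.re ∧ ρ.re ≤ 1 ∧ ρ.im ≠ 0 ∧
          (‖ρ - (1 / 2 + η + γ₀ * I)‖ ≤ δ₁ ∨ ‖ρ - (1 / 2 - η + γ₀ * I)‖ ≤ δ₁)) →
      (∀ ρ : ℂ, riemannZeta ρ = 0 → 0 ≤ ρ.re → ρ.re ≤ 1 → |ρ.im - γ₀| < R → ρ.re ≠ 1 / 2 →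
          ρ = 1 / 2 + η + γ₀ * I ∨ ρ = 1 / 2 - η + γ₀ * I ∨ ρ ∈ S' ∨ ρ ∈ P ∨
            (|ρ.re - 1 / 2| ≤ θ ∧ Δ₀ ≤ |ρ.im - γ₀|)) →
      2 * bumpLaplace ψ (-η) ≤ Real.exp (η * c) * bumpLaplace ψ η →
      (clusterKp ψ N R₀ p * (1 + Real.exp (θ * (c + 1)) ^ 2 / Δ₀ ^ (2 * p + 2))
          * Real.log (|γ₀| + 2) <
          η ^ 4 * δ ^ (4 * N) *
            (Real.exp (η * c) * bumpLaplace ψ η - bumpLaplace ψ (-η)) ^ 2) →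
      weilGroundEnergy (c + 1) < 0 := by
  intro η θ γ₀ c R δ Δ₀ δ₁ S' P hη hη2 hθ2 hγ hc hR hRa hδ hδ1 hΔ hζ hcard hclus hδ₁ hδ₁η hδ₁δ hPgeo
    hloc hreg hwin
  unfold clusterKp at hwin
  have hT := weilGroundEnergy_neg_of_local_oddTest_cluster_far_undodged
  have hgainpos : bumpLaplace ψ (-η) ≤ Real.exp (η * c) * bumpLaplace ψ η := by
    linarith [bumpLaplace_nonneg hψ0 (-η)]
  set A₁ : ℝ := zetaDensityConst
  have hA₁ : 0 < A₁ := zetaDensityConst_pos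
  set Q : ℝ := (1 + R₀ ^ 2) ^ N * bumpNormSum ψ (2 * N + 4 + p) with hQ_def
  have hQ0 : 0 ≤ Q := by have := bumpNormSum_nonneg ψ (2 * N + 4 + p); positivity
  set X : ℝ := Real.exp (θ * (c + 1)) ^ 2 / Δ₀ ^ (2 * p + 2) with hX_def
  have hΔ0 : 0 < Δ₀ := by linarith
  have hX0 : 0 ≤ X := by positivity
  set g : ℝ := Real.exp (η * c) * bumpLaplace ψ η - bumpLaplace ψ (-η) with hg_def
  have hlog : 0 < Real.log (|γ₀| + 2) := Real.log_pos (by linarith [abs_nonneg γ₀])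
  have hXL : 0 ≤ X * Real.log (|γ₀| + 2) := mul_nonneg hX0 hlog.le
  have hAXL : 0 ≤ A₁ * Q ^ 2 * X * Real.log (|γ₀| + 2) := by
    have := hA₁.le; positivity
  have hg0 : 0 ≤ g := sub_nonneg.mpr hgainpos
  have hgpos : 0 < g := by
    rcases hg0.lt_or_eq with h | h
    · exact h
    · exfalso
      rw [← h] at hwin
      have : 0 < (16 * A₁ * Q ^ 2 + 1) * (1 + X) * Real.log (|γ₀| + 2) := by positivity
      norm_num at hwin
      linarith
  -- the cluster test and the far set
  obtain ⟨k, hk_eq, hk, hkodd, hks, hpos, hnorm, hG, hvan⟩ :=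
    exists_clusterTest_gen_eq hψ hsupp hψ0 N R₀ p (γ₀ := γ₀) (S' := S') hη hc hδ hδ1 hcard hclus
      hgpos
  -- the un-dodged condition on `P` (T37b)
  have hsep : ∀ ρ ∈ S', δ ≤ ‖ρ - (1 / 2 + η + γ₀ * I)‖ ∧ δ ≤ ‖ρ - (1 / 2 - η + γ₀ * I)‖ :=
    fun ρ hρ ↦ ⟨(hclus ρ hρ).2.1, (hclus ρ hρ).2.2⟩
  have hP : ∀ ρ ∈ P, riemannZeta ρ = 0 ∧ 0 ≤ ρ.re ∧ ρ.re ≤ 1 ∧ ρ.im ≠ 0 ∧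
      ‖weilMellin (fun t ↦ k t * cexp (-(γ₀ * I) * t)) ρ‖ ^ 2 ≤
        ‖weilMellin (fun t ↦ k t * cexp (-(γ₀ * I) * t)) ρ -
            weilMellin (fun t ↦ k t * cexp (-(γ₀ * I) * t)) (1 - conj ρ)‖ ^ 2 / 2 := by
    intro ρ hρ
    obtain ⟨hz, h0, h1, him, hnearρ⟩ := hPgeo ρ hρ
    refine ⟨hz, h0, h1, him, ?_⟩
    rw [hk_eq]
    exact undodged_condition_near_pair hψ hsupp hψ0 hη hη2.le hc hreg hδ hcard hsep hδ₁ hδ₁η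
      hδ₁δ hnearρ
  obtain ⟨Sf, hSf_mem, hSf_all⟩ := exists_far_finset θ γ₀ R Δ₀ hθ2
  have hSf1 : ∀ ρ ∈ Sf, ρ ≠ 1 := by
    intro ρ hρ h1
    have hz := (hSf_mem ρ hρ).1
    rw [h1] at hz
    exact riemannZeta_one_ne_zero hz
  have hloc5 : ∀ ρ : ℂ, riemannZeta ρ = 0 → 0 ≤ ρ.re → ρ.re ≤ 1 → |ρ.im - γ₀| < R →
      ρ.re ≠ 1 / 2 →
        ρ = 1 / 2 + η + γ₀ * I ∨ ρ = 1 / 2 - η + γ₀ * I ∨ ρ ∈ S' ∨ ρ ∈ Sf ∨ ρ ∈ P := by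
    intro ρ hz h0 h1 hnear hre
    rcases hloc ρ hz h0 h1 hnear hre with h | h | h | h | ⟨hoff, hfarρ⟩
    · exact Or.inl h
    · exact Or.inr (Or.inl h)
    · exact Or.inr (Or.inr (Or.inl h))
    · exact Or.inr (Or.inr (Or.inr (Or.inr h)))
    · exact Or.inr (Or.inr (Or.inr (Or.inl (hSf_all ρ hz hoff hfarρ hnear))))
  -- the on-line majorant (as in T25)
  have hk1 : ∫ t, ‖k t‖ ≤ 2 * Q := by simpa using hnorm 0 (by omega)
  have hk2 : ∫ t, ‖deriv k t‖ ≤ 2 * Q := by simpa using hnorm 1 (by omega)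
  have hk3 : ∫ t, ‖iteratedDeriv 2 k t‖ ≤ 2 * Q := hnorm 2 (by omega)
  have hkp : ∫ t, ‖iteratedDeriv (p + 2) k t‖ ≤ 2 * Q := hnorm (p + 2) le_rfl
  have hMloc : ((∫ t, ‖k t‖) ^ 2 + (∫ t, ‖deriv k t‖) ^ 2)
      + 2 * Real.exp (c + 1) * (∫ t, ‖iteratedDeriv 2 k t‖) ^ 2 / R ^ (2 * 1)
        ≤ 4 * (Q ^ 2 + Q ^ 2 + 2 * Q ^ 2) :=
    local_majorant_arith (integral_nonneg fun _ ↦ norm_nonneg _)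
      (integral_nonneg fun _ ↦ norm_nonneg _) (integral_nonneg fun _ ↦ norm_nonneg _) hk1 hk2 hk3
      (Real.exp_pos _) (by simpa using hRa)
  have h1 : 2 * A₁ * (((∫ t, ‖k t‖) ^ 2 + (∫ t, ‖deriv k t‖) ^ 2)
      + 2 * Real.exp (c + 1) * (∫ t, ‖iteratedDeriv 2 k t‖) ^ 2 / R ^ (2 * 1))
        * Real.log (|γ₀| + 2)
      ≤ 2 * A₁ * (4 * (Q ^ 2 + Q ^ 2 + 2 * Q ^ 2)) * Real.log (|γ₀| + 2) :=
    mul_le_mul_of_nonneg_right (mul_le_mul_of_nonneg_left hMloc (by positivity)) hlog.le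
  -- the far terms (T28a with decay order `p + 2`)
  have hF1 := sum_offline_far_le hk (by linarith : (0 : ℝ) ≤ c + 1) hks hθ2 hΔ
    (p := p + 2) (by omega) Sf hSf_mem
  have hBf : 2 * A₁ * (2 * (Real.exp (θ * (c + 1)) * ∫ t, ‖iteratedDeriv (p + 2) k t‖) ^ 2
      / Δ₀ ^ (2 * (p + 2) - 2)) * Real.log (|γ₀| + 2) ≤
      16 * (A₁ * Q ^ 2 * X * Real.log (|γ₀| + 2)) := by
    have h22 : Δ₀ ^ (2 * (p + 2) - 2) = Δ₀ ^ (2 * p + 2) := by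
      rw [show 2 * (p + 2) - 2 = 2 * p + 2 by omega]
    rw [h22]
    have hEN : (Real.exp (θ * (c + 1)) * ∫ t, ‖iteratedDeriv (p + 2) k t‖) ^ 2 ≤
        (Real.exp (θ * (c + 1)) * (2 * Q)) ^ 2 :=
      pow_le_pow_left₀ (by positivity) (mul_le_mul_of_nonneg_left hkp (Real.exp_pos _).le) 2
    have h3 : 2 * (Real.exp (θ * (c + 1)) * ∫ t, ‖iteratedDeriv (p + 2) k t‖) ^ 2
        / Δ₀ ^ (2 * p + 2) ≤
        2 * (Real.exp (θ * (c + 1)) * (2 * Q)) ^ 2 / Δ₀ ^ (2 * p + 2) :=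
      div_le_div_of_nonneg_right (by linarith) (by positivity)
    have h4 := mul_le_mul_of_nonneg_right (mul_le_mul_of_nonneg_left h3
      (by positivity : (0 : ℝ) ≤ 2 * A₁)) hlog.le
    refine h4.trans_eq ?_
    rw [hX_def]
    ring
  -- the zero has multiplicity `≥ 1`
  have hne1 : (1 / 2 + η + γ₀ * I : ℂ) ≠ 1 := by
    intro h
    apply hγ
    have := congrArg Complex.im h
    simpa using this
  have hm1 : (1 : ℝ) ≤ (riemannZetaZeroOrder (1 / 2 + η + γ₀ * I) : ℝ) := by
    have := (riemannZetaZeroOrder_pos_iff hne1).mpr hζ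
    have h1m : (1 : ℤ) ≤ riemannZetaZeroOrder (1 / 2 + η + γ₀ * I) := by omega
    exact_mod_cast h1m
  have hmP := mul_le_mul_of_nonneg_right hm1 (sq_nonneg ‖∫ t, k t * cexp ((η : ℂ) * t)‖)
  have h2 : 2 * A₁ * (4 * (Q ^ 2 + Q ^ 2 + 2 * Q ^ 2)) * Real.log (|γ₀| + 2)
      + 2 * A₁ * (2 * (Real.exp (θ * (c + 1)) * ∫ t, ‖iteratedDeriv (p + 2) k t‖) ^ 2
          / Δ₀ ^ (2 * (p + 2) - 2)) * Real.log (|γ₀| + 2) <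
      2 * ((riemannZetaZeroOrder (1 / 2 + η + γ₀ * I) : ℝ)
        * ‖∫ t, k t * cexp ((η : ℂ) * t)‖ ^ 2) := by
    linarith [hwin, hG, hmP, hlog, hBf, hXL, hAXL]
  have key := hT k (c + 1) η γ₀ R _ 1 S' Sf P hk hkodd (by linarith) hR hks hpos hζ
    (abs_lt.mpr ⟨by linarith, hη2⟩) hη.ne' hγ hvan hSf1 hF1 hP hloc5
  exact key (by linarith [h1, h2])

/-! ## T34‴: window form -/

/-- The gain regime from the window constant: `c ≥ c₀,p` gives `2Φ(−η) ≤ e^{ηc}Φ(η)`. -/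
theorem two_mul_bumpLaplace_le_of_clusterFarC0p_le (hψ0 : ∀ s, 0 ≤ ψ s) {η : ℝ} (hη : 0 < η)
    (hΦ : 0 < bumpLaplace ψ η) {N : ℕ} {R₀ : ℝ} {p : ℕ} {δ c : ℝ}
    (hc : clusterFarC0p ψ N R₀ p δ η ≤ c) :
    2 * bumpLaplace ψ (-η) ≤ Real.exp (η * c) * bumpLaplace ψ η := by
  set Φ := bumpLaplace ψ η with hΦ_def
  set Φm := bumpLaplace ψ (-η) with hΦm_def
  have hΦm : 0 ≤ Φm := bumpLaplace_nonneg hψ0 (-η)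
  have hc₁ : Real.log (2 * Φm / Φ + 1) / η ≤ c := le_trans (le_max_left _ _) hc
  have hq1 : 0 < 2 * Φm / Φ + 1 := by positivity
  have h1 : Real.log (2 * Φm / Φ + 1) ≤ η * c := by
    rw [div_le_iff₀ hη] at hc₁; linarith
  have i1 : 2 * Φm / Φ + 1 ≤ Real.exp (η * c) := by
    have := Real.exp_le_exp.mpr h1
    rwa [Real.exp_log hq1] at this
  have i1' : 2 * Φm + Φ ≤ Real.exp (η * c) * Φ := by
    have := mul_le_mul_of_nonneg_right i1 hΦ.le
    rwa [add_mul, one_mul, div_mul_cancel₀ _ hΦ.ne'] at this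
  linarith

/-- **T34‴ (window form with un-dodged members).**  As T34 with the exempt set `P` of
T33‴ (`256(c+1)δ₁ ≤ η`, `64(N+1)δ₁ ≤ δ`); the gain regime `2Φ(−η) ≤ e^{ηc}Φ(η)` follows from
`c ≥ c₀,p`. -/
theorem weilGroundEnergy_neg_of_farOffset_cluster_undodged_window_eff (hψ : ContDiff ℝ ∞ ψ)
    (hsupp : tsupport ψ ⊆ Icc (-1) 1) (hψ0 : ∀ s, 0 ≤ ψ s) {η : ℝ} (hη : 0 < η)
    (hη2 : η < 1 / 2) (hΦ : 0 < bumpLaplace ψ η) (N : ℕ) (R₀ : ℝ) (p : ℕ) {δ : ℝ} (hδ : 0 < δ)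
    (hδ1 : δ ≤ 1) {θ : ℝ} (hθ2 : θ < 1 / 2) :
    ∀ (γ₀ c R Δ₀ δ₁ : ℝ) (S' P : Finset ℂ), 1 ≤ |γ₀| →
      clusterFarC0p ψ N R₀ p δ η + Real.log (Real.log (|γ₀| + 2)) / (2 * η) ≤ c → 1 ≤ R →
      Real.exp (c + 1) ≤ R ^ 2 → Real.exp (θ * (c + 1)) ≤ Δ₀ ^ (p + 1) → 1 ≤ Δ₀ →
      riemannZeta (1 / 2 + η + γ₀ * I) = 0 → S'.card ≤ N →
      (∀ ρ ∈ S', ‖ρ - (1 / 2 + γ₀ * I)‖ ≤ R₀ ∧ δ ≤ ‖ρ - (1 / 2 + η + γ₀ * I)‖ ∧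
          δ ≤ ‖ρ - (1 / 2 - η + γ₀ * I)‖) →
      0 ≤ δ₁ → 256 * (c + 1) * δ₁ ≤ η → 64 * (N + 1) * δ₁ ≤ δ →
      (∀ ρ ∈ P, riemannZeta ρ = 0 ∧ 0 ≤ ρ.re ∧ ρ.re ≤ 1 ∧ ρ.im ≠ 0 ∧
          (‖ρ - (1 / 2 + η + γ₀ * I)‖ ≤ δ₁ ∨ ‖ρ - (1 / 2 - η + γ₀ * I)‖ ≤ δ₁)) →
      (∀ ρ : ℂ, riemannZeta ρ = 0 → 0 ≤ ρ.re → ρ.re ≤ 1 → |ρ.im - γ₀| < R → ρ.re ≠ 1 / 2 →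
          ρ = 1 / 2 + η + γ₀ * I ∨ ρ = 1 / 2 - η + γ₀ * I ∨ ρ ∈ S' ∨ ρ ∈ P ∨
            (|ρ.re - 1 / 2| ≤ θ ∧ Δ₀ ≤ |ρ.im - γ₀|)) →
      weilGroundEnergy (c + 1) < 0 := by
  intro γ₀ c R Δ₀ δ₁ S' P hγ hc hR hRa hΔ hΔ1 hζ hcard hclus hδ₁ hδ₁η hδ₁δ hP hloc
  have hreg : 2 * bumpLaplace ψ (-η) ≤ Real.exp (η * c) * bumpLaplace ψ η :=
    two_mul_bumpLaplace_le_of_clusterFarC0p_le hψ0 hη hΦ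
      (le_trans (le_add_of_nonneg_right (by
        have hL : 1 < Real.log (|γ₀| + 2) := by
          rw [Real.lt_log_iff_exp_lt (by positivity)]
          linarith [Real.exp_one_lt_d9, abs_nonneg γ₀]
        have := (Real.log_pos hL).le
        positivity)) hc)
  unfold clusterFarC0p at hc
  have hδN : 0 < δ ^ (4 * N) := by positivity
  have hK := clusterKp_pos ψ N R₀ p
  have hKδ : 0 < 2 * clusterKp ψ N R₀ p / δ ^ (4 * N) := by positivity
  obtain ⟨hc0, hdom, hwin⟩ :=
    doubleLog_window_arith hKδ hΦ (bumpLaplace_nonneg hψ0 (-η)) hη hγ hc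
  have hγ0 : γ₀ ≠ 0 := by intro h; rw [h, abs_zero] at hγ; linarith
  have hΔ0 : 0 < Δ₀ := by linarith
  have hX : Real.exp (θ * (c + 1)) ^ 2 / Δ₀ ^ (2 * p + 2) ≤ 1 := by
    rw [div_le_one (by positivity), show 2 * p + 2 = (p + 1) * 2 by ring, pow_mul]
    exact pow_le_pow_left₀ (Real.exp_pos _).le hΔ 2
  have hlog : 0 < Real.log (|γ₀| + 2) := Real.log_pos (by linarith [abs_nonneg γ₀])
  have hwin' : clusterKp ψ N R₀ p * (1 + Real.exp (θ * (c + 1)) ^ 2 / Δ₀ ^ (2 * p + 2))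
      * Real.log (|γ₀| + 2) <
      η ^ 4 * δ ^ (4 * N) *
        (Real.exp (η * c) * bumpLaplace ψ η - bumpLaplace ψ (-η)) ^ 2 := by
    have h := mul_lt_mul_of_pos_left hwin hδN
    have hδne : δ ^ (4 * N) ≠ 0 := hδN.ne'
    have e : δ ^ (4 * N) * (2 * clusterKp ψ N R₀ p / δ ^ (4 * N) * Real.log (|γ₀| + 2)) =
        2 * clusterKp ψ N R₀ p * Real.log (|γ₀| + 2) := by
      field_simp
    rw [e] at h
    have hKL : 0 ≤ clusterKp ψ N R₀ p * Real.log (|γ₀| + 2) := by positivity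
    calc clusterKp ψ N R₀ p * (1 + Real.exp (θ * (c + 1)) ^ 2 / Δ₀ ^ (2 * p + 2))
          * Real.log (|γ₀| + 2)
        = (1 + Real.exp (θ * (c + 1)) ^ 2 / Δ₀ ^ (2 * p + 2))
            * (clusterKp ψ N R₀ p * Real.log (|γ₀| + 2)) := by ring
      _ ≤ 2 * (clusterKp ψ N R₀ p * Real.log (|γ₀| + 2)) :=
          mul_le_mul_of_nonneg_right (by linarith) hKL
      _ = 2 * clusterKp ψ N R₀ p * Real.log (|γ₀| + 2) := by ring
      _ < δ ^ (4 * N) * (η ^ 4 *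
            (Real.exp (η * c) * bumpLaplace ψ η - bumpLaplace ψ (-η)) ^ 2) := h
      _ = η ^ 4 * δ ^ (4 * N) *
            (Real.exp (η * c) * bumpLaplace ψ η - bumpLaplace ψ (-η)) ^ 2 := by ring
  exact weilGroundEnergy_neg_of_farOffset_cluster_undodged_eff hψ hsupp hψ0 N R₀ p η θ γ₀ c R δ Δ₀
    δ₁ S' P hη hη2 hθ2 hγ0 hc0 hR hRa hδ hδ1 hΔ1 hζ hcard hclus hδ₁ hδ₁η hδ₁δ hP hloc hreg hwin'

end Summit.RiemannHypothesis.RiemannHypothesis.Theorems
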